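import Literature.Probability.LatticeModels.IsingTorusTransfer
import Literature.LinearAlgebra.Matrix.PerronSymmetric
import HarnessLib

/-!
# The cylinder state of the Ising transfer matrix: the limit `M → ∞` as a ground-state expectation

Topic `Probability/LatticeModels`, namespace `Literature.Probability.LatticeModels`. Step E3a of
the exact-solution programme behind `Literature.Probability.LatticeModels.onsager_yang`
(`OnsagerYang.lean`, `OnsagerYangProofs.lean`, `OnsagerToeplitz.lean`): the remaining exact input
`torusRowPair_tendsto_toeplitzDet` asks for the limit, as the width `N → ∞`, of the inner limits
`lim_M ⟨σ_{(0,0)}σ_{(k,0)}⟩_{p,NM}`, which `IsingTorusTransfer.tendsto_torusRowPair_inner` proves to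
EXIST (as the average of the pair observable over the top eigenspace of the symmetrised transfer
matrix `A = E V E`). Here that inner limit is IDENTIFIED:

* `symTransfer_apply_pos` — `A = E V E` has strictly positive entries (all Boltzmann factors are
  exponentials), so Perron's theorem (`Literature.LinearAlgebra.Matrix.PerronSymmetric`, proved)
  applies: the largest eigenvalue `Λ_N` of `A` is positive and simple, with a positive eigenvector;
* `tendsto_torusRowPair_groundState` — **Schultz–Mattis–Lieb 1964, §II ("only the largest
  eigenvalue survives"), made precise**: for `β ≥ 0`, `N ≥ 1` and ANY nonzero eigenvector `Ω` of
  `A` for `Λ_N`, `⟨σ_{(0,0)}σ_{(k,0)}⟩_{p,NM} → ⟨Ω, D_k Ω⟩/⟨Ω, Ω⟩` as `M → ∞`, `D_k = diag(r₀ r_k)`;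
  hence `lim_M ⟨σ_{(0,0)}σ_{(k,0)}⟩_{p,NM} = ∑_r r₀ r_k Ω(r)² / ∑_r Ω(r)²`
  (`limUnder_torusRowPair_eq_groundState`). This is the form in which the fermionic solution
  (Kaufman 1949; Schultz–Mattis–Lieb 1964, §§III–V) enters: it constructs an eigenvector `Ω` of
  the (even sector of the) transfer matrix with eigenvalue `Λ_N` and evaluates `⟨Ω, D_k Ω⟩` by
  Wick's theorem as a determinant — no positivity of that `Ω` needs to be checked;
* (the operator form `V = ∏ᵢ (e^{β} 1 + e^{-β} σˣᵢ)` and its Kramers–Wannier rewriting live in the sibling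
  `IsingTransferOperator.lean`).

## References

* T. D. Schultz, D. C. Mattis, E. H. Lieb, Rev. Mod. Phys. 36 (1964) 856–871, §II.
* B. Kaufman, Phys. Rev. 76 (1949) 1232–1243.
* J. Ding, A. Zhou, *Nonnegative Matrices, Positive Operators, and Applications* (2009), Thm 2.1.
-/

noncomputable section

open Matrix Finset Filter Topology Literature.LinearAlgebra.Matrix

namespace Literature.Probability.LatticeModels

variable {N : ℕ}

/-! ### Positivity of the symmetrised transfer matrix -/

/-- The symmetrised transfer matrix `A = E V E` entrywise:
`A(r,r') = e^{β H_row(r)/2} e^{β ∑_i r_i r'_i} e^{β H_row(r')/2}`. [cite: SchultzMattisLieb1964, §II] -/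
theorem symTransfer_apply (β : ℝ) (r r' : Row N) :
    symTransfer N β r r' =
      Real.exp (β * rowEnergy N r / 2) * Real.exp (β * vertEnergy N r r') *
        Real.exp (β * rowEnergy N r' / 2) := by
  rw [symTransfer, halfRowDiag, mul_diagonal, diagonal_mul]
  rfl

/-- **`A = E V E` has strictly positive entries** (products of exponentials), the hypothesis of
Perron's theorem. [cite: SchultzMattisLieb1964, §II] -/
theorem symTransfer_apply_pos (β : ℝ) (r r' : Row N) : 0 < symTransfer N β r r' := by
  rw [symTransfer_apply]
  exact mul_pos (mul_pos (Real.exp_pos _) (Real.exp_pos _)) (Real.exp_pos _)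

/-! ### The inner limit as a ground-state expectation -/

/-- The pair observable `r ↦ r₀ r_k` on rows of length `N ≥ 1` (the diagonal of `D_k`). [cite: SchultzMattisLieb1964, §II] -/
def rowPairObs (N k : ℕ) (hN : 0 < N) (r : Row N) : ℝ :=
  spinAt (⟨0, hN⟩ : Fin N) r * spinAt (⟨k % N, Nat.mod_lt k hN⟩ : Fin N) r

/-- **Schultz–Mattis–Lieb 1964, §II, made precise by Perron's theorem**: for `β ≥ 0`, `N ≥ 1`, every
`k`, and ANY nonzero eigenvector `Ω` of the symmetrised transfer matrix `A = E V E` for its largest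
eigenvalue, the periodic two-point function of the `N × M` torus converges, as `M → ∞`, to the
ground-state expectation `⟨Ω, D_k Ω⟩ / ⟨Ω, Ω⟩` of the diagonal pair observable. (The tree's
`tendsto_torusRowPair_inner` gave existence only; `A` is positive semidefinite for `β ≥ 0` and has
positive entries, so `Literature.LinearAlgebra.Matrix.tendsto_trace_mul_pow_div_of_perron`
applies.) [cite: SchultzMattisLieb1964, §II] -/
theorem tendsto_torusRowPair_groundState {β : ℝ} (hβ : 0 ≤ β) (hN : 0 < N) (k : ℕ)
    {Ω : Row N → ℝ} (hΩ0 : Ω ≠ 0)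
    (hΩ : symTransfer N β *ᵥ Ω = topEigenvalue (symTransfer_posSemidef (N := N) hβ).1 • Ω) :
    Tendsto (fun M : ℕ => torusRowPair β N M k) atTop
      (𝓝 ((Ω ⬝ᵥ (diagonal (rowPairObs N k hN) *ᵥ Ω)) / (Ω ⬝ᵥ Ω))) := by
  classical
  have hlim := tendsto_trace_mul_pow_div_of_perron (symTransfer_posSemidef (N := N) hβ)
    (symTransfer_apply_pos β) (diagonal (rowPairObs N k hN)) hΩ0 hΩ
  rw [← tendsto_add_atTop_iff_nat 3]
  have hfun : (fun m : ℕ => torusRowPair β N (m + 3) k) = fun m : ℕ =>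
      (diagonal (rowPairObs N k hN) * symTransfer N β ^ (m + 3)).trace /
        (symTransfer N β ^ (m + 3)).trace := by
    funext m
    rw [torusRowPair_eq_trace_div β hN m k, trace_diagonal_mul_transferW_pow,
      trace_diagonal_mul_transferW_pow, Matrix.diagonal_one, Matrix.one_mul]
    rfl
  rw [hfun]
  exact hlim.comp (tendsto_add_atTop_nat 3)

/-- The inner limit of BGJS (3.3) is the ground-state expectation: for `β ≥ 0`, `N ≥ 1` and any
nonzero top eigenvector `Ω` of `A`,
`lim_M ⟨σ_{(0,0)}σ_{(k,0)}⟩_{p,NM} = ⟨Ω, D_k Ω⟩/⟨Ω, Ω⟩ = ∑_r r₀r_k Ω(r)² / ∑_r Ω(r)²`. [cite: SchultzMattisLieb1964, §II] -/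
theorem limUnder_torusRowPair_eq_groundState {β : ℝ} (hβ : 0 ≤ β) (hN : 0 < N) (k : ℕ)
    {Ω : Row N → ℝ} (hΩ0 : Ω ≠ 0)
    (hΩ : symTransfer N β *ᵥ Ω = topEigenvalue (symTransfer_posSemidef (N := N) hβ).1 • Ω) :
    limUnder atTop (fun M : ℕ => torusRowPair β N M k) =
      (∑ r, rowPairObs N k hN r * Ω r ^ 2) / ∑ r, Ω r ^ 2 := by
  rw [(tendsto_torusRowPair_groundState hβ hN k hΩ0 hΩ).limUnder_eq]
  congr 1
  · rw [dotProduct]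
    exact sum_congr rfl fun r _ => by rw [mulVec_diagonal]; ring
  · rw [dotProduct]
    exact sum_congr rfl fun r _ => by ring

end Literature.Probability.LatticeModels
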